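import Summits.QuantumFields.YangMills.Theorems.ColdStartUniversalityLatticeLangevinPermutationCovariance
import Summits.QuantumFields.YangMills.Theorems.ColdStartUniversalityUniformColdStartMixingIntegrand
import HarnessLib

/-!
# Route `ColdStartUniversality` (cruxes 27363 / 24810 / aside 24809): COLD-START LOOP-STRING EXPECTATIONS ARE INVARIANT
# UNDER THE AXIS PERMUTATIONS `S₃` — `E[∏_{C∈os} W̄_{πC}(U_t)] = E[∏_{C∈os} W̄_C(U_t)]`

Helper file (seat `ym-line-csu-p1`, g14; `--supports stmt-QuantumFields-27363`).  Companion of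
`…LatticeLangevinPermutationCovariance` (`integral_permute_coldStart`) and `…LatticeLangevinTranslationStrings`
(p721167): with the tree's static covariance `T3Family.avgObs_permute` (Bałaban (2.17): relabelling a unit label by
`π ∈ S₃` = pulling the fine configuration back by `π`),

* `toField_compPermute` — dictionary: `U ∘ σ_π` read as a level-0 field is `GaugeField.permute π` of the field read from `U`;
* ★ `integral_string_permute_coldStart` — `E[∏_{C∈os} avgObs K (C.permute π) (U_t)] = E[∏_{C∈os} avgObs K C (U_t)]` for
  every cold-start solution, `K`, `t`, `π`, `os`.

THEOREMS ONLY, [folklore]; RECORD-rung R3 plumbing; no crux, rung or summit statement is proved here and the Yang–Mills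
mass gap is NOT proved.
-/

set_option autoImplicit false

noncomputable section

namespace Summit.QuantumFields.YangMills.Theorems.ColdStartUniversality.TranslationCovariance

open MeasureTheory
open scoped NNReal
open Literature.MathematicalPhysics.QuantumFieldTheory
open Literature.MathematicalPhysics.QuantumLattice (fundamentalRep fundamentalLatticeRep continuous_fundamentalRep)

section Strings

open Literature.MathematicalPhysics.QuantumFieldTheory.Balaban1983to89

variable (F : T3ContinuumYM3Torus.T3Family) (K : ℕ)

/-- **Dictionary**: `U ∘ σ_π` read as a level-0 field is the tree's `GaugeField.permute π` of the field read from `U`. [folklore] -/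
theorem toField_compPermute (π : Equiv.Perm (Fin 3))
    (U : GaugeConfig 3 ((F.P K).sitesPerDir 0) (Matrix.specialUnitaryGroup (Fin 2) ℂ)) :
    (fun b : PBond (F.P K) 0 => (fun e : Edge 3 ((F.P K).sitesPerDir 0) => U ((fun ν => e.1 (π.symm ν)), π e.2))
      (b.src, b.dir)) =
      GaugeField.permute (P := F.P K) (j := 0) π
        (fun b : PBond (F.P K) 0 => U (b.src, b.dir) : GaugeField (F.P K) 0 (Matrix.specialUnitaryGroup (Fin 2) ℂ)) := by
  funext b
  rfl

/-- ★ **COLD-START LOOP-STRING EXPECTATIONS ARE INVARIANT UNDER AXIS PERMUTATIONS.**  For every cold-start solution of the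
step-`K` SZZ dynamics (any coupling, space, flat driver), every `t`, `π ∈ S₃` and loop string `os`:
`E[∏_{C∈os} avgObs K (π C) (U_t)] = E[∏_{C∈os} avgObs K C (U_t)]`. [cite: Balaban1987RG1, (2.17) p.269] -/
theorem integral_string_permute_coldStart (β' : ℝ) (π : Equiv.Perm (Fin 3)) (os : List (T3ContinuumYM3Torus.ULoop3 F))
    {Ω : Type} {mΩ : MeasurableSpace Ω} {P : Measure Ω} [IsProbabilityMeasure P]
    {W : ℝ≥0 → Ω → (Edge 3 ((F.P K).sitesPerDir 0) × NoiseIdx 2 → ℝ)} (hW : IsFlatBrownian W P)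
    {U : ℝ≥0 → Ω → GaugeConfig 3 ((F.P K).sitesPerDir 0) (Matrix.specialUnitaryGroup (Fin 2) ℂ)}
    (hU0 : ∀ ω, U 0 ω = fun _ => 1)
    (hU : (latticeLangevinDynamics (fundamentalLatticeRep 2) β').IsSolution (fundamentalRep (Fin 2))
      hW.natFiltration P W U) (t : ℝ≥0) :
    ∫ ω, (os.map fun C => F.avgObs (ExpMeanLog.expMeanLogSU : LoopAverage (Matrix.specialUnitaryGroup (Fin 2) ℂ)) K
        (C.permute π) (fun b : PBond (F.P K) 0 => U t ω (b.src, b.dir))).prod ∂P =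
      ∫ ω, (os.map fun C => F.avgObs (ExpMeanLog.expMeanLogSU : LoopAverage (Matrix.specialUnitaryGroup (Fin 2) ℂ)) K C
        (fun b : PBond (F.P K) 0 => U t ω (b.src, b.dir))).prod ∂P := by
  set g : GaugeConfig 3 ((F.P K).sitesPerDir 0) (Matrix.specialUnitaryGroup (Fin 2) ℂ) → ℝ := fun V =>
    (os.map fun C => F.avgObs (ExpMeanLog.expMeanLogSU : LoopAverage (Matrix.specialUnitaryGroup (Fin 2) ℂ)) K C
      (fun b : PBond (F.P K) 0 => V (b.src, b.dir))).prod with hg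
  have hm : ∀ K' C, Measurable ((F.scheme (ExpMeanLog.expMeanLogSU :
      LoopAverage (Matrix.specialUnitaryGroup (Fin 2) ℂ)) 1).obs K' C) := fun K' C =>
    F.measurable_avgObs (F.avgMeasurable_of_measurableE _ T4ApexTwoLevel.measurableE_expMeanLogSU) K' C
  have hΦ : Measurable fun V : GaugeConfig 3 ((F.P K).sitesPerDir 0) (Matrix.specialUnitaryGroup (Fin 2) ℂ) =>
      (fun b : PBond (F.P K) 0 => V (b.src, b.dir) : GaugeField (F.P K) 0 (Matrix.specialUnitaryGroup (Fin 2) ℂ)) :=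
    measurable_pi_lambda _ fun b => measurable_pi_apply _
  have hgm : Measurable g := (T4GenFunBounds.measurable_prodObs _ hm K os).comp hΦ
  have hstat : ∀ ω, (os.map fun C => F.avgObs (ExpMeanLog.expMeanLogSU : LoopAverage (Matrix.specialUnitaryGroup (Fin 2) ℂ)) K
      (C.permute π) (fun b : PBond (F.P K) 0 => U t ω (b.src, b.dir))).prod =
      g (fun e : Edge 3 ((F.P K).sitesPerDir 0) => U t ω ((fun ν => e.1 (π.symm ν)), π e.2)) := by
    intro ω
    simp only [hg]
    rw [toField_compPermute F K π (U t ω)]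
    congr 1
    refine List.map_congr_left fun C _ => ?_
    exact F.avgObs_permute _ K π C _
  simp_rw [hstat]
  exact integral_permute_coldStart β' π hW hU0 hU hgm t

end Strings

end Summit.QuantumFields.YangMills.Theorems.ColdStartUniversality.TranslationCovariance

end
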